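import Literature.Probability.LatticeModels.CriticalScalingDimension
import Literature.Probability.LatticeModels.HighDimPointwiseTriviality
import HarnessLib

/-!
# Crux `IsingEuclidUpgradeR4NonGaussian` (stmt-CriticalPhenomena-0636), line `free-covariance-delta-dichotomy`:
# the dyadic bubble bound below `Δ = 3/4` (helper obligation `stub_momentRatioBubble` of the
# registered stub `stub_momentRatioLowerBound`)

THEOREM-ONLY helper file (no definitions). For a pointwise scaling limit `S` of the critical Ising₃
correlators with non-degenerate two-point function and the covariance relation
`S₂(0,2e₀) = 2^{-2Δ}S₂(0,e₀)` (a consequence of scale covariance on non-coincident configurations),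
and `Δ < 3/4`:

  `∃ K > 0, ∃ i₀, ∀ J ≥ i₀, ∑_{‖u‖_∞ ≤ 2^{J+2}} ⟨σ₀σ_u⟩²_{β_c} ≤ K · 8^J · ⟨σ₀σ_{2^J e₀}⟩²_{β_c}`

(`stub_momentRatioBubble`): the bubble diagram at scale `2^J` is carried by its top dyadic shell.
Mechanism: each dyadic shell `2^{j+2} < ‖u‖_∞ ≤ 2^{j+3}` is bounded by its axis value
`⟨σ₀σ_{2^j e₀}⟩` (Messager–Miracle-Solé, tree theorem `twoPointPlus_le_of_mul_supNorm_le`), and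
`⟨σ₀σ_{2^j e₀}⟩²/⟨σ₀σ_{2^{j+1}e₀}⟩² → 2^{4Δ} < 8` along the dyadic meshes (tree theorem
`tendsto_rescaled_dyadic` at `(0,e₀)` and `(0,2e₀)`), so `8^j⟨σ₀σ_{2^j e₀}⟩²` grows geometrically —
this is the only place of the moment-ratio bound where `4Δ < 3` enters (ADC21 §4.2: the bubble
condition of Lemma 4.4 in `d = 3`).

References: M. Aizenman, H. Duminil-Copin, Ann. Math. 194 (2021) = arXiv:1912.07973, §4.2 Lemma 4.4;
A. Messager, S. Miracle-Solé, J. Stat. Phys. 17 (1977).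
-/

noncomputable section

open Filter Topology Set Function MeasureTheory Finset
open Literature.Probability.LatticeModels Literature.Probability.Percolation

namespace Summit.CriticalPhenomena.Ising3DConformalLimit.Cruxes.IsingEuclidUpgradeR4NonGaussian.FreeCovarianceDeltaDichotomy

/-- `0 < ⟨σ₀σ_u⟩_{β_c}` on `ℤ³` (Simon–Lieb lower bound off the origin, `= 1` at the origin). [folklore] -/
private theorem criticalTwoPoint_pos (u : Site 3) : 0 < criticalTwoPoint 3 u := by
  by_cases hu : u = 0
  · rw [hu, criticalTwoPoint_zero']; exact one_pos
  · obtain ⟨c, C, hc, h⟩ := criticalTwoPoint_bounds_holds (d := 3) le_rfl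
    have hn : 0 < ‖u‖ := norm_pos_iff.2 hu
    exact lt_of_lt_of_le (mul_pos hc (Real.rpow_pos_of_pos hn _)) (h u hu).1

/-- `‖m e₀‖_∞ = m`. [folklore] -/
private theorem supNorm_single_nat (m : ℕ) :
    Site.supNorm (Pi.single (0 : Fin 3) (m : ℤ) : Site 3) = m := by
  apply le_antisymm
  · rw [Site.supNorm_le_iff]
    intro j
    by_cases hj : j = 0
    · subst hj; simp
    · rw [Pi.single_eq_of_ne hj]; simp
  · have := Site.natAbs_le_supNorm (Pi.single (0 : Fin 3) (m : ℤ) : Site 3) 0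
    simpa using this

/-- Messager–Miracle-Solé: `⟨σ₀σ_u⟩ ≤ ⟨σ₀σ_{m e₀}⟩` whenever `3m ≤ ‖u‖_∞`.
[cite: MessagerMiracleSoleJSP1977, Theorem (monotonicity)] -/
private theorem criticalTwoPoint_le_axis {u : Site 3} {m : ℕ} (h : 3 * m ≤ Site.supNorm u) :
    criticalTwoPoint 3 u ≤ criticalTwoPoint 3 (Pi.single (0 : Fin 3) (m : ℤ)) :=
  twoPointPlus_le_of_mul_supNorm_le (d := 3) (criticalBeta_nonneg 3)
    (x := Pi.single (0 : Fin 3) (m : ℤ)) (y := u) (by rwa [supNorm_single_nat])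

/-- **Dyadic ratio bound**: for `4Δ < 3` there is `θ < 8` with
`⟨σ₀σ_{2^i e₀}⟩² ≤ θ ⟨σ₀σ_{2^{i+1}e₀}⟩²` for all large `i`
(`⟨σ₀σ_{2^i e₀}⟩/⟨σ₀σ_{2^{i+1}e₀}⟩ → 2^{2Δ}` from the limit at `(0,e₀)`, `(0,2e₀)`). [folklore] -/
private theorem eventually_dyadic_sq_le {ρ : ℝ → ℝ} {S : CorrFamily 3} {Δ : ℝ}
    (hlim : HasPointwiseScalingLimit (criticalCorr 3) ρ S) (hnd : IsNondegenerateTwoPoint S)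
    (hs₂eq : S 2 ![0, EuclideanSpace.single (0 : Fin 3) ((2 : ℕ) : ℝ)] =
      (2 : ℝ) ^ (-(2 : ℝ) * Δ) * S 2 ![0, EuclideanSpace.single (0 : Fin 3) ((1 : ℕ) : ℝ)])
    (hΔ : Δ < 3 / 4) :
    ∃ θ : ℝ, 0 < θ ∧ θ < 8 ∧ ∀ᶠ i : ℕ in atTop,
      criticalTwoPoint 3 (Pi.single (0 : Fin 3) ((2:ℤ) ^ i)) ^ 2 ≤
        θ * criticalTwoPoint 3 (Pi.single (0 : Fin 3) ((2:ℤ) ^ (i + 1))) ^ 2 := by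
  set s₁ := S 2 ![0, EuclideanSpace.single (0 : Fin 3) ((1 : ℕ) : ℝ)] with hs₁
  set s₂ := S 2 ![0, EuclideanSpace.single (0 : Fin 3) ((2 : ℕ) : ℝ)] with hs₂
  have hs₁pos : 0 < s₁ := hnd _ (zero_unitVec_mem_nonCoincident (by norm_num))
  have hs₂pos : 0 < s₂ := hnd _ (zero_unitVec_mem_nonCoincident (by norm_num))
  -- θ₀ = s₁²/s₂² = 2^{4Δ} < 8
  set θ₀ : ℝ := s₁ ^ 2 / s₂ ^ 2 with hθ₀def
  have hθ₀ : θ₀ = (2:ℝ) ^ (4 * Δ) := by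
    rw [hθ₀def, hs₂eq, eq_comm, eq_div_iff (by positivity), mul_pow, ← mul_assoc,
      pow_two ((2:ℝ) ^ (-(2:ℝ) * Δ)), ← mul_assoc, ← Real.rpow_add two_pos,
      ← Real.rpow_add two_pos]
    have : 4 * Δ + -(2:ℝ) * Δ + -(2:ℝ) * Δ = 0 := by ring
    rw [this, Real.rpow_zero, one_mul]
  have hθ₀8 : θ₀ < 8 := by
    rw [hθ₀]
    calc (2:ℝ) ^ (4 * Δ) < (2:ℝ) ^ (3:ℝ) :=
          Real.rpow_lt_rpow_of_exponent_lt one_lt_two (by linarith)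
      _ = 8 := by norm_num
  have hθ₀pos : 0 < θ₀ := by rw [hθ₀]; positivity
  set θ : ℝ := (θ₀ + 8) / 2 with hθdef
  have hθθ : θ₀ < θ := by rw [hθdef]; linarith
  refine ⟨θ, by rw [hθdef]; linarith, by rw [hθdef]; linarith, ?_⟩
  -- the two dyadic sequences
  have h1 := tendsto_rescaled_dyadic hlim (t := 1) one_ne_zero
  have h2 := tendsto_rescaled_dyadic hlim (t := 2) two_ne_zero
  have hsq := (h1.pow 2).div (h2.pow 2) (pow_ne_zero 2 hs₂pos.ne')
  have hev := hsq.eventually_lt_const hθθ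
  have hpos := h2.eventually_const_lt hs₂pos
  obtain ⟨N, hN⟩ := eventually_atTop.1 (hev.and hpos)
  refine eventually_atTop.2 ⟨N + 1, fun i hi => ?_⟩
  obtain ⟨k, rfl⟩ : ∃ k, i = k + 1 := ⟨i - 1, by omega⟩
  obtain ⟨hk1, hk2⟩ := hN k (by omega)
  have e1 : (((1:ℕ):ℤ) * 2 ^ (k + 1)) = (2:ℤ) ^ (k + 1) := by push_cast; ring
  have e2 : (((2:ℕ):ℤ) * 2 ^ (k + 1)) = (2:ℤ) ^ (k + 1 + 1) := by push_cast; ring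
  simp only [e1, e2, Pi.div_apply] at hk1 hk2
  set r := ρ ((2:ℝ)⁻¹ ^ (k + 1)) ^ 2 with hr
  set g₁ := criticalTwoPoint 3 (Pi.single (0 : Fin 3) ((2:ℤ) ^ (k + 1))) with hg₁
  set g₂ := criticalTwoPoint 3 (Pi.single (0 : Fin 3) ((2:ℤ) ^ (k + 1 + 1))) with hg₂
  have hrpos : 0 < r := by
    rcases (sq_nonneg (ρ ((2:ℝ)⁻¹ ^ (k + 1)))).lt_or_eq with h | h
    · exact h
    · exfalso; rw [hr, ← h, zero_mul] at hk2; exact lt_irrefl _ hk2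
  have hq : 0 < (r * g₂) ^ 2 := by positivity
  rw [div_lt_iff₀ hq] at hk1
  rw [mul_pow, mul_pow] at hk1
  have hr2 : 0 < r ^ 2 := by positivity
  nlinarith [hk1, hr2]

/-- **Helper obligation `stub_momentRatioBubble` — the dyadic bubble bound below `Δ = 3/4`**:
there are `K > 0` and `i₀` with `∑_{‖u‖_∞ ≤ 2^{J+2}} ⟨σ₀σ_u⟩² ≤ K · 8^J · ⟨σ₀σ_{2^J e₀}⟩²` for all
`J ≥ i₀` — the bubble at scale `2^J` is carried by its top dyadic shell (geometric growth of
`8^j⟨σ₀σ_{2^j e₀}⟩²`, ratio `> 1` exactly when `4Δ < 3`; MMS bounds each shell by the axis value).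
[cite: AizenmanDuminilCopinAnnals2021, §4.2, Lemma 4.4] -/
theorem stub_momentRatioBubble :
    ∀ (ρ : ℝ → ℝ) (S : CorrFamily 3) (Δ : ℝ), HasPointwiseScalingLimit (criticalCorr 3) ρ S →
      IsNondegenerateTwoPoint S →
      S 2 ![0, EuclideanSpace.single (0 : Fin 3) ((2 : ℕ) : ℝ)] =
        (2 : ℝ) ^ (-(2 : ℝ) * Δ) * S 2 ![0, EuclideanSpace.single (0 : Fin 3) ((1 : ℕ) : ℝ)] →
      Δ < 3 / 4 →
      ∃ K : ℝ, 0 < K ∧ ∃ i₀ : ℕ, ∀ J : ℕ, i₀ ≤ J →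
        ∑ u ∈ box 3 (2 ^ (J + 2)), criticalTwoPoint 3 u ^ 2 ≤
          K * 8 ^ J * criticalTwoPoint 3 (Pi.single (0 : Fin 3) ((2:ℤ) ^ J)) ^ 2 := by
  intro ρ S Δ hlim hnd hs₂eq hΔ
  obtain ⟨θ, hθ, hθ8, hev⟩ := eventually_dyadic_sq_le hlim hnd hs₂eq hΔ
  obtain ⟨i₀, hi₀⟩ := eventually_atTop.1 hev
  set g : ℕ → ℝ := fun J => criticalTwoPoint 3 (Pi.single (0 : Fin 3) ((2:ℤ) ^ J)) with hgdef
  set Φ : ℕ → ℝ := fun J => ∑ u ∈ box 3 (2 ^ (J + 2)), criticalTwoPoint 3 u ^ 2 with hΦdef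
  have hgpos : ∀ J, 0 < g J := fun J => criticalTwoPoint_pos _
  -- one-step recurrence
  have hstep : ∀ J, Φ (J + 1) ≤ Φ J + 2 ^ 15 * 8 ^ J * g J ^ 2 := by
    intro J
    have hsub : box 3 (2 ^ (J + 2)) ⊆ box 3 (2 ^ (J + 1 + 2)) :=
      box_mono 3 (Nat.pow_le_pow_right (by norm_num) (by omega))
    have hsplit := Finset.sum_sdiff hsub (f := fun u => criticalTwoPoint 3 u ^ 2)
    simp only [hΦdef]
    rw [← hsplit, add_comm]
    refine add_le_add le_rfl ?_
    -- each term of the shell is `≤ g J ^ 2`, and there are `≤ 2^15 8^J` of them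
    have hterm : ∀ u ∈ box 3 (2 ^ (J + 1 + 2)) \ box 3 (2 ^ (J + 2)),
        criticalTwoPoint 3 u ^ 2 ≤ g J ^ 2 := by
      intro u hu
      rw [Finset.mem_sdiff, mem_box_iff_supNorm_le, mem_box_iff_supNorm_le] at hu
      have h3 : 3 * 2 ^ J ≤ Site.supNorm u := by
        have : 2 ^ (J + 2) = 4 * 2 ^ J := by ring
        omega
      have hle := criticalTwoPoint_le_axis (u := u) (m := 2 ^ J) h3
      push_cast at hle
      exact pow_le_pow_left₀ (criticalTwoPoint_nonneg' u) hle 2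
    have hcard : (#(box 3 (2 ^ (J + 1 + 2)) \ box 3 (2 ^ (J + 2))) : ℝ) ≤ 2 ^ 15 * 8 ^ J := by
      have h1 : #(box 3 (2 ^ (J + 1 + 2)) \ box 3 (2 ^ (J + 2))) ≤ #(box 3 (2 ^ (J + 1 + 2))) :=
        Finset.card_le_card Finset.sdiff_subset
      rw [card_box] at h1
      have h2 : (2 * 2 ^ (J + 1 + 2) + 1) ^ 3 ≤ 2 ^ 15 * 8 ^ J := by
        have : 2 * 2 ^ (J + 1 + 2) + 1 ≤ 2 ^ (J + 5) := by
          have : 2 ^ (J + 5) = 2 * 2 ^ (J + 1 + 2) + 2 * 2 ^ (J + 1 + 2) := by ring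
          have : 1 ≤ 2 ^ (J + 1 + 2) := Nat.one_le_two_pow
          omega
        calc (2 * 2 ^ (J + 1 + 2) + 1) ^ 3 ≤ (2 ^ (J + 5)) ^ 3 := Nat.pow_le_pow_left this 3
          _ = 2 ^ 15 * 8 ^ J := by
            rw [← pow_mul, show (8:ℕ) = 2 ^ 3 by norm_num, ← pow_mul, ← pow_add]; ring_nf
      exact_mod_cast h1.trans h2
    calc ∑ u ∈ box 3 (2 ^ (J + 1 + 2)) \ box 3 (2 ^ (J + 2)), criticalTwoPoint 3 u ^ 2
        ≤ ∑ _u ∈ box 3 (2 ^ (J + 1 + 2)) \ box 3 (2 ^ (J + 2)), g J ^ 2 := Finset.sum_le_sum hterm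
      _ = (#(box 3 (2 ^ (J + 1 + 2)) \ box 3 (2 ^ (J + 2))) : ℝ) * g J ^ 2 := by
        rw [Finset.sum_const, nsmul_eq_mul]
      _ ≤ 2 ^ 15 * 8 ^ J * g J ^ 2 := mul_le_mul_of_nonneg_right hcard (sq_nonneg _)
  -- the constant
  set K : ℝ := max (Φ i₀ / (8 ^ i₀ * g i₀ ^ 2)) (2 ^ 15 * θ / (8 - θ)) with hKdef
  have hK2 : 2 ^ 15 * θ / (8 - θ) ≤ K := le_max_right _ _
  have hK1 : Φ i₀ / (8 ^ i₀ * g i₀ ^ 2) ≤ K := le_max_left _ _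
  have hKpos : 0 < K := lt_of_lt_of_le (div_pos (mul_pos (by norm_num) hθ) (by linarith)) hK2
  refine ⟨K, hKpos, i₀, fun J hJ => ?_⟩
  induction J, hJ using Nat.le_induction with
  | base =>
    have hden : 0 < (8:ℝ) ^ i₀ * g i₀ ^ 2 := mul_pos (by positivity) (pow_pos (hgpos i₀) 2)
    have := (div_le_iff₀ hden).1 hK1
    simpa [hΦdef, hgdef, mul_assoc] using this
  | succ J hJ ih =>
    have hθJ := hi₀ J hJ
    have hKθ : (K + 2 ^ 15) * θ ≤ 8 * K := by
      have h8 : 0 < 8 - θ := by linarith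
      have := (div_le_iff₀ h8).1 hK2
      nlinarith
    have h8J : (0:ℝ) < 8 ^ J := by positivity
    calc Φ (J + 1) ≤ Φ J + 2 ^ 15 * 8 ^ J * g J ^ 2 := hstep J
      _ ≤ K * 8 ^ J * g J ^ 2 + 2 ^ 15 * 8 ^ J * g J ^ 2 := by
          have : Φ J ≤ K * 8 ^ J * g J ^ 2 := by simpa [hΦdef, hgdef] using ih
          linarith
      _ = (K + 2 ^ 15) * 8 ^ J * g J ^ 2 := by ring
      _ ≤ (K + 2 ^ 15) * 8 ^ J * (θ * g (J + 1) ^ 2) := by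
          refine mul_le_mul_of_nonneg_left ?_ (by positivity)
          simpa [hgdef] using hθJ
      _ = ((K + 2 ^ 15) * θ) * 8 ^ J * g (J + 1) ^ 2 := by ring
      _ ≤ (8 * K) * 8 ^ J * g (J + 1) ^ 2 := by
          refine mul_le_mul_of_nonneg_right (mul_le_mul_of_nonneg_right hKθ h8J.le) (sq_nonneg _)
      _ = K * 8 ^ (J + 1) * g (J + 1) ^ 2 := by ring

end Summit.CriticalPhenomena.Ising3DConformalLimit.Cruxes.IsingEuclidUpgradeR4NonGaussian.FreeCovarianceDeltaDichotomy

end
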